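import Summits.QuantumFields.BalabanUV.Beta.GAN24.WoodburyFibreGaugeInputs

/-!
# Beta / GAN24 / WoodburyFibreGaugeBox — census row V9 on Bałaban's Neumann boxes (`A = 0`), the DERIVED INPUTS of R20: decay of
the minimiser `ℋ̃ = minimiser (boxOpR n a m² M) Qn` (entrywise and column-cube), of the hard fluctuation covariance
`Γ = flucCov (boxOpR n a m² M) Qn` (cube currency), and invertibility of the bi-form `L·L + Qnᴴ(c·1)Qn` and of its pivot —
every constant an explicit function of the scalar data, NO dependence on the scale

Cell `pub-balaban`, β sub-cell, BINDER ROW **G-an2-4 ∕ (CONV-C)** («NOT IN PRINT; our proof attempt»), prover part **P3 =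
WOODBURY-FIBRE reduction** (lineage `b2b-balaban-gan24-p3`, gen 6).  HONEST FRAMING (verbatim): discharging `BetaPertH`
makes Bałaban's UV stability UNCONDITIONAL — a real constructive-QFT result; it is NOT the continuum limit and NOT the Clay
problem.  HONEST DEPENDENCY: continuum YM on T⁴ ⇐ BetaPertH ∧ nine spine estimates (0/9 proved); BetaPertH ⇐ (D1) ∧ (D4) ∧
CAP+tail; G-an2-4 gates asym, D1 and NE2/3/4.  `[folklore]` bookkeeping over tree theorems; 0 sorry; nothing printed and
nothing programme-internal is used as a hypothesis; nothing of (CONV-C) ∕ `BetaPertH` is discharged here.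

## Scalar data ⇒ derived decays (one box `X = Π_μ[0, n·M_μ)`, `n ≥ 1`; typing of `GAN24/WoodburyFibreGaugeInputs`)

Given `hG : CubeDecay (rho M) blkBox id G cG δ` for `G = (boxOpR n a m² M)⁻¹` (for all scales this is B4 (1.10),
`WoodburyFibreGaugeInputs.cubeDecay_boxGreen`) and `hco : Coercive (n^{−(d+1)}·S·G·Sᵀ) γ` (for all scales this is
`WoodburyFibreBoxQGQ.qGq_box_coercive`), with `δP := rate K γ cG δ` (`K = latticeConst (d+1)`), `s = n^{−(d+1)/2}`:
* §1 `posDecay_pivotQn_inv` (finite Combes–Thomas `B5Decay126.PosDecay.inv` on the pivot `Q_kG_kQ_k^*`: constant `2/γ`, rate `δP`);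
  **`posDecay_minimiser`** `PosDecay ℋ̃ (s·cG·(2/γ)·K(δP/2)) (δP/2)`; **`colCube_minimiser`** `ColCubeDecay ℋ̃ (s·n^{d+1}·cG·(2/γ)·K(δP/2)) (δP/2)`
  (the product of the two constants is `n`-free); **`cubeDecay_flucCov`** `CubeDecay Γ (cGam K γ cG δ) (δP/4)`,
  `cGam = cG + cG²(2/γ)K(δP/2)K(δP/4)` (via `Γ = G − ℋ̃·Qn·G` and R20's `posDecay_mul_colCube`);
* §2 `biForm_form` (`v ⬝ (L·L + Qnᴴ(c·1)Qn)v = ‖Lv‖² + (c/n^{d+1})‖Sv‖²`, `L = boxOpR n 0 m² M`), `isUnit_biForm`,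
  `isUnit_pivot_biForm` (`c > 0`): the two invertibility inputs of R17/R20 for the regularised bi-form, by positivity and
  `boxOpR_isUnit` — no spectral theory.
THE END (R20 on these inputs, all scales) is `GAN24/WoodburyFibreLandauBox`.
-/

namespace Summit.QuantumFields.BalabanUV.Beta.GAN24.WoodburyFibreGaugeBox

open Finset Matrix
open Literature.MathematicalPhysics.QuantumFieldTheory.Balaban1983to89
open B4Reflection242 (boxDom)
open B4BoxCov237 (boxOpR indB rho rho_isPseudoDist boxOpR_isUnit boxOpR_form_nonneg)
open B4Sect5Torus (IsPseudoDist rate rate_pos rate_le_quarter)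
open B4Sect5Proof (latticeConst)
open B5Decay126 (PosDecay PosProfile)
open B6QGQLower276 (gammaQ gammaQ_pos)
open Summit.QuantumFields.BalabanUV.Beta.PropagatorWoodburyFibre (pivot effForm minimiser flucCov)
open WoodburyFibreGaugeCubeDecay (CubeDecay ColCubeDecay cubeDecay_flucCov_sq posDecay_mul_colCube)
open WoodburyFibreBoxQGQ (fineN blkBox boxOpR_eq_add_gram sGs_coercive qGq_box_coercive coercive_mono)
open WoodburyFibreGaugeInputs

noncomputable section

variable {d : ℕ}

/-! ## §1 The decays of the minimiser `ℋ̃ = minimiser (boxOpR n a m² M) Qn` and of `Γ = flucCov (boxOpR n a m² M) Qn`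
from the scalar data: cube decay `(cG, δ)` of `G`, coercivity `γ` of `Q_kG_kQ_k^*` -/

section Derived

variable {n : ℕ} (hn : 1 ≤ n) (M : Fin (d + 1) → ℕ) {a m2 cG δ γ : ℝ}

/-- the pivot `Qn G Qnᴴ = Q_kG_kQ_k^*` decays entrywise with constant `cG`. [folklore] -/
theorem posDecay_pivotQn (hG : CubeDecay (rho M) (blkBox hn M) id (boxOpR n a m2 M)⁻¹ cG δ) :
    PosDecay (rho M) id id (pivot (boxOpR n a m2 M) (Qn n M)) cG δ := by
  have hn0 : (0 : ℝ) < n := by exact_mod_cast hn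
  have hN : (0 : ℝ) < (n : ℝ) ^ (d + 1) := by positivity
  have h := (posDecay_pivot hn M hG).smul (((n : ℝ) ^ (d + 1))⁻¹)
  rw [← pivot_eq M hn a m2, abs_of_pos (inv_pos.2 hN), ← mul_assoc, inv_mul_cancel₀ hN.ne', one_mul] at h
  exact h

/-- **finite Combes–Thomas on the pivot**: `(Q_kG_kQ_k^*)⁻¹` decays with constant `2/γ` at `δP = rate K γ cG δ`. [folklore] -/
theorem posDecay_pivotQn_inv (hδ : 0 < δ) (hγ : 0 < γ)
    (hG : CubeDecay (rho M) (blkBox hn M) id (boxOpR n a m2 M)⁻¹ cG δ)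
    (hco : QGQInverse.Coercive ((((n : ℝ) ^ (d + 1))⁻¹) • (indB n M * (boxOpR n a m2 M)⁻¹ * (indB n M)ᵀ)) γ) :
    PosDecay (rho M) id id (pivot (boxOpR n a m2 M) (Qn n M))⁻¹ (2 / γ) (rate (latticeConst (d + 1)) γ cG δ) := by
  have hco' : QGQInverse.Coercive (pivot (boxOpR n a m2 M) (Qn n M)) γ := by rw [pivot_eq M hn]; exact hco
  exact PosDecay.inv (rho_isPseudoDist M) (latticeConst_nonneg' d) (posProfile_rho M) hγ hδ (posDecay_pivotQn hn M hG)
    hco'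

/-- the leg `G·Qnᴴ`, entrywise (constant `s·cG`, `s = n^{−(d+1)/2}`). [folklore] -/
theorem posDecay_G_QnT (hG : CubeDecay (rho M) (blkBox hn M) id (boxOpR n a m2 M)⁻¹ cG δ) :
    PosDecay (rho M) (id ∘ blkBox hn M) id ((boxOpR n a m2 M)⁻¹ * (Qn n M)ᴴ) (sN d n * cG) δ := by
  rw [Qn_conjTranspose, Matrix.mul_smul]
  have h := (posDecay_G_indBT hn M hG).smul (sN d n)
  rwa [abs_of_pos (sN_pos hn)] at h

/-- the leg `G·Qnᴴ`, column cube sums (constant `s·n^{d+1}·cG`). [folklore] -/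
theorem colCube_G_QnT (hG : CubeDecay (rho M) (blkBox hn M) id (boxOpR n a m2 M)⁻¹ cG δ) :
    ColCubeDecay (rho M) (blkBox hn M) id ((boxOpR n a m2 M)⁻¹ * (Qn n M)ᴴ) (sN d n * ((n : ℝ) ^ (d + 1) * cG)) δ := by
  rw [Qn_conjTranspose, Matrix.mul_smul]
  have h := ColCubeDecay.smul (colCube_G_indBT hn M hG) (sN d n)
  rwa [abs_of_pos (sN_pos hn)] at h

/-- **THE MINIMISER, ENTRYWISE**: `PosDecay ℋ̃ (s·cG·(2/γ)·K(δP/2)) (δP/2)`. [folklore] -/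
theorem posDecay_minimiser (hδ : 0 < δ) (hγ : 0 < γ)
    (hG : CubeDecay (rho M) (blkBox hn M) id (boxOpR n a m2 M)⁻¹ cG δ)
    (hco : QGQInverse.Coercive ((((n : ℝ) ^ (d + 1))⁻¹) • (indB n M * (boxOpR n a m2 M)⁻¹ * (indB n M)ᵀ)) γ) :
    PosDecay (rho M) (id ∘ blkBox hn M) id (minimiser (boxOpR n a m2 M) (Qn n M))
      (sN d n * cG * (2 / γ) * latticeConst (d + 1) (rate (latticeConst (d + 1)) γ cG δ / 2))
      (rate (latticeConst (d + 1)) γ cG δ / 2) := by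
  have hP := rate_pos (latticeConst_nonneg' d) hγ hG.1 hδ
  have h4 : rate (latticeConst (d + 1)) γ cG δ ≤ δ / 4 := rate_le_quarter _ _ _
  rw [minimiser_eq]
  exact PosDecay.mul (rho_isPseudoDist M) (latticeConst_nonneg' d) (posProfile_rho M) (posDecay_G_QnT hn M hG)
    (posDecay_pivotQn_inv hn M hδ hγ hG hco) (by positivity) (by positivity) (by linarith) (by linarith)

/-- **THE MINIMISER, COLUMN CUBE SUMS**: `ColCubeDecay ℋ̃ (s·n^{d+1}·cG·(2/γ)·K(δP/2)) (δP/2)`. [folklore] -/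
theorem colCube_minimiser (hδ : 0 < δ) (hγ : 0 < γ)
    (hG : CubeDecay (rho M) (blkBox hn M) id (boxOpR n a m2 M)⁻¹ cG δ)
    (hco : QGQInverse.Coercive ((((n : ℝ) ^ (d + 1))⁻¹) • (indB n M * (boxOpR n a m2 M)⁻¹ * (indB n M)ᵀ)) γ) :
    ColCubeDecay (rho M) (blkBox hn M) id (minimiser (boxOpR n a m2 M) (Qn n M))
      (sN d n * ((n : ℝ) ^ (d + 1) * cG) * (2 / γ) * latticeConst (d + 1) (rate (latticeConst (d + 1)) γ cG δ / 2))
      (rate (latticeConst (d + 1)) γ cG δ / 2) := by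
  have hP := rate_pos (latticeConst_nonneg' d) hγ hG.1 hδ
  have h4 : rate (latticeConst (d + 1)) γ cG δ ≤ δ / 4 := rate_le_quarter _ _ _
  rw [minimiser_eq]
  exact colCubeDecay_mul_posDecay (rho_isPseudoDist M) (latticeConst_nonneg' d) (posProfile_rho M)
    (colCube_G_QnT hn M hG) (posDecay_pivotQn_inv hn M hδ hγ hG hco) (by positivity) (by positivity) (by linarith)
    (by linarith)

/-- the correction `ℋ̃·Qn·G` in the cube currency, rate `δP/4`. [folklore] -/
theorem cubeDecay_minimiser_Qn_G (hδ : 0 < δ) (hγ : 0 < γ)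
    (hG : CubeDecay (rho M) (blkBox hn M) id (boxOpR n a m2 M)⁻¹ cG δ)
    (hco : QGQInverse.Coercive ((((n : ℝ) ^ (d + 1))⁻¹) • (indB n M * (boxOpR n a m2 M)⁻¹ * (indB n M)ᵀ)) γ) :
    CubeDecay (rho M) (blkBox hn M) id
      (minimiser (boxOpR n a m2 M) (Qn n M) * (Qn n M * (boxOpR n a m2 M)⁻¹))
      ((sN d n * cG * (2 / γ) * latticeConst (d + 1) (rate (latticeConst (d + 1)) γ cG δ / 2))
        * (sN d n * ((n : ℝ) ^ (d + 1) * cG)) * latticeConst (d + 1) (rate (latticeConst (d + 1)) γ cG δ / 4))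
      (rate (latticeConst (d + 1)) γ cG δ / 4) := by
  have hP := rate_pos (latticeConst_nonneg' d) hγ hG.1 hδ
  have h4 : rate (latticeConst (d + 1)) γ cG δ ≤ δ / 4 := rate_le_quarter _ _ _
  rw [← conjTranspose_G_QnT M a m2]
  exact posDecay_mul_colCube (rho_isPseudoDist M) (latticeConst_nonneg' d) (posProfile_rho M)
    (posDecay_minimiser hn M hδ hγ hG hco) (colCube_G_QnT hn M hG) (by positivity) (by positivity) (by linarith)
    (by linarith)

/-- the constant of `Γ`: `cΓ = cG + cG²·(2/γ)·K(δP/2)·K(δP/4)`. [folklore] -/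
def cGam (K : ℝ → ℝ) (γ cG δ : ℝ) : ℝ :=
  cG + cG ^ 2 * (2 / γ) * K (rate K γ cG δ / 2) * K (rate K γ cG δ / 4)

/-- **THE HARD FLUCTUATION COVARIANCE IN THE CUBE CURRENCY**: `CubeDecay Γ cΓ (δP/4)` with
`Γ = flucCov (boxOpR n a m² M) Qn = G − ℋ̃·Qn·G`. [folklore] -/
theorem cubeDecay_flucCov (hδ : 0 < δ) (hγ : 0 < γ)
    (hG : CubeDecay (rho M) (blkBox hn M) id (boxOpR n a m2 M)⁻¹ cG δ)
    (hco : QGQInverse.Coercive ((((n : ℝ) ^ (d + 1))⁻¹) • (indB n M * (boxOpR n a m2 M)⁻¹ * (indB n M)ᵀ)) γ) :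
    CubeDecay (rho M) (blkBox hn M) id (flucCov (boxOpR n a m2 M) (Qn n M))
      (cGam (latticeConst (d + 1)) γ cG δ) (rate (latticeConst (d + 1)) γ cG δ / 4) := by
  have h4 : rate (latticeConst (d + 1)) γ cG δ ≤ δ / 4 := rate_le_quarter _ _ _
  have hP := rate_pos (latticeConst_nonneg' d) hγ hG.1 hδ
  have h := CubeDecay.sub (rho_isPseudoDist M) hG (cubeDecay_minimiser_Qn_G hn M hδ hγ hG hco)
    (δ := rate (latticeConst (d + 1)) γ cG δ / 4) (by linarith) le_rfl
  rw [flucCov_eq_sub, Matrix.mul_assoc]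
  have key := sN_mul_sN_mul (d := d) hn
  have e : cG + sN d n * cG * (2 / γ) * latticeConst (d + 1) (rate (latticeConst (d + 1)) γ cG δ / 2)
        * (sN d n * ((n : ℝ) ^ (d + 1) * cG)) * latticeConst (d + 1) (rate (latticeConst (d + 1)) γ cG δ / 4)
      = cGam (latticeConst (d + 1)) γ cG δ := by
    unfold cGam
    calc _ = cG + (sN d n * sN d n * (n : ℝ) ^ (d + 1)) * (cG ^ 2 * (2 / γ)
          * latticeConst (d + 1) (rate (latticeConst (d + 1)) γ cG δ / 2)
          * latticeConst (d + 1) (rate (latticeConst (d + 1)) γ cG δ / 4)) := by ring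
      _ = _ := by rw [key]; ring
  rw [e] at h
  exact h

end Derived

/-! ## §2 The bi-form `L·L + Qnᴴ(c·1)Qn` and its pivot are invertible (positivity) -/

section BiForm

/-- the quadratic form of the bi-form: `v ⬝ (L·L + Qnᴴ(c·1)Qn)v = ‖Lv‖² + (c/n^{d+1})‖Sv‖²`. [folklore] -/
theorem biForm_form {n : ℕ} (hn : 1 ≤ n) (M : Fin (d + 1) → ℕ) {m2 : ℝ} (c : ℝ) (v : ↥(boxDom (fineN n M)) → ℝ) :
    v ⬝ᵥ ((boxOpR n 0 m2 M * boxOpR n 0 m2 M + (Qn n M)ᴴ * (c • (1 : Matrix ↥(boxDom M) ↥(boxDom M) ℝ)) * Qn n M) *ᵥ v)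
      = (boxOpR n 0 m2 M *ᵥ v) ⬝ᵥ (boxOpR n 0 m2 M *ᵥ v)
        + c * (((n : ℝ) ^ (d + 1))⁻¹) * ((indB n M *ᵥ v) ⬝ᵥ (indB n M *ᵥ v)) := by
  have hLT : (boxOpR n 0 m2 M)ᵀ = boxOpR n 0 m2 M := B4BoxCov237.boxOpR_isSymm n 0 m2 M
  rw [reg_eq M hn, Matrix.add_mulVec, dotProduct_add, ← Matrix.mulVec_mulVec, Matrix.dotProduct_mulVec v,
    ← hLT, Matrix.vecMul_transpose, hLT, Matrix.smul_mulVec, dotProduct_smul, smul_eq_mul, ← Matrix.mulVec_mulVec,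
    Matrix.dotProduct_mulVec v (indB n M)ᵀ, Matrix.vecMul_transpose]

/-- the bi-form is definite: `v ⬝ (L·L + Qnᴴ(c·1)Qn)v = 0 ⇒ v = 0` (`c > 0`; then `Lv = 0` and `Sv = 0`, so `boxOpR n 1 m² M·v = 0`).
[folklore] -/
theorem eq_zero_of_biForm_form_eq_zero {n : ℕ} (hn : 1 ≤ n) (M : Fin (d + 1) → ℕ) {m2 : ℝ} (hM : ∀ i, 1 ≤ M i) (hm : 0 ≤ m2) {c : ℝ} (hc : 0 < c)
    {v : ↥(boxDom (fineN n M)) → ℝ}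
    (h0 : v ⬝ᵥ ((boxOpR n 0 m2 M * boxOpR n 0 m2 M + (Qn n M)ᴴ * (c • (1 : Matrix ↥(boxDom M) ↥(boxDom M) ℝ)) * Qn n M)
      *ᵥ v) = 0) : v = 0 := by
  have hn0 : (0 : ℝ) < n := by exact_mod_cast hn
  have hN : (0 : ℝ) < ((n : ℝ) ^ (d + 1))⁻¹ := by positivity
  rw [biForm_form hn M] at h0
  have h1 : 0 ≤ (boxOpR n 0 m2 M *ᵥ v) ⬝ᵥ (boxOpR n 0 m2 M *ᵥ v) := Finset.sum_nonneg fun i _ => mul_self_nonneg _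
  have h2 : 0 ≤ (indB n M *ᵥ v) ⬝ᵥ (indB n M *ᵥ v) := Finset.sum_nonneg fun i _ => mul_self_nonneg _
  have hcN : 0 < c * ((n : ℝ) ^ (d + 1))⁻¹ := mul_pos hc hN
  have hL : boxOpR n 0 m2 M *ᵥ v = 0 := dotProduct_self_eq_zero.1 (by nlinarith)
  have hS : indB n M *ᵥ v = 0 := dotProduct_self_eq_zero.1 (by nlinarith)
  have hA : boxOpR n 1 m2 M *ᵥ v = 0 := by
    rw [boxOpR_eq_add_gram hn 1 m2 M, Matrix.add_mulVec, hL, Matrix.smul_mulVec, ← Matrix.mulVec_mulVec, hS,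
      Matrix.mulVec_zero, smul_zero, add_zero]
  have hinj := Matrix.mulVec_injective_iff_isUnit.2 (boxOpR_isUnit hn one_pos hm hM)
  exact hinj (by rw [hA, Matrix.mulVec_zero])

/-- **the bi-form is a unit**. [folklore] -/
theorem isUnit_biForm {n : ℕ} (hn : 1 ≤ n) (M : Fin (d + 1) → ℕ) {m2 : ℝ} (hM : ∀ i, 1 ≤ M i) (hm : 0 ≤ m2) {c : ℝ} (hc : 0 < c) :
    IsUnit (boxOpR n 0 m2 M * boxOpR n 0 m2 M + (Qn n M)ᴴ * (c • (1 : Matrix ↥(boxDom M) ↥(boxDom M) ℝ)) * Qn n M) := by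
  refine Matrix.mulVec_injective_iff_isUnit.1 fun v w hvw => sub_eq_zero.1 (eq_zero_of_biForm_form_eq_zero hn M hM hm hc ?_)
  have : (boxOpR n 0 m2 M * boxOpR n 0 m2 M + (Qn n M)ᴴ * (c • (1 : Matrix ↥(boxDom M) ↥(boxDom M) ℝ)) * Qn n M)
      *ᵥ (v - w) = 0 := by
    rw [Matrix.mulVec_sub]; exact sub_eq_zero.2 hvw
  rw [this, dotProduct_zero]

/-- **the pivot of the bi-form is a unit** (`Qnᴴ` is injective since `QnQnᴴ = 1`, and the inverse bi-form is definite).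
[folklore] -/
theorem isUnit_pivot_biForm {n : ℕ} (hn : 1 ≤ n) (M : Fin (d + 1) → ℕ) {m2 : ℝ} (hM : ∀ i, 1 ≤ M i) (hm : 0 ≤ m2) {c : ℝ} (hc : 0 < c) :
    IsUnit (pivot (boxOpR n 0 m2 M * boxOpR n 0 m2 M
      + (Qn n M)ᴴ * (c • (1 : Matrix ↥(boxDom M) ↥(boxDom M) ℝ)) * Qn n M) (Qn n M)) := by
  set B := boxOpR n 0 m2 M * boxOpR n 0 m2 M + (Qn n M)ᴴ * (c • (1 : Matrix ↥(boxDom M) ↥(boxDom M) ℝ)) * Qn n M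
    with hB
  have hBdet : IsUnit B.det := (Matrix.isUnit_iff_isUnit_det B).1 (isUnit_biForm hn M hM hm hc)
  have key : ∀ w : ↥(boxDom M) → ℝ, pivot B (Qn n M) *ᵥ w = 0 → w = 0 := by
    intro w hw
    set u := (Qn n M)ᴴ *ᵥ w with hu
    set z := B⁻¹ *ᵥ u with hz
    have hBz : B *ᵥ z = u := by rw [hz, Matrix.mulVec_mulVec, Matrix.mul_nonsing_inv _ hBdet, Matrix.one_mulVec]
    have hQz : Qn n M *ᵥ z = 0 := by
      rw [pivot, ← Matrix.mulVec_mulVec, ← Matrix.mulVec_mulVec] at hw; exact hw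
    have h0 : z ⬝ᵥ (B *ᵥ z) = 0 := by
      rw [hBz, hu, Matrix.conjTranspose_eq_transpose_of_trivial, Matrix.mulVec_transpose, dotProduct_comm,
        ← Matrix.dotProduct_mulVec, hQz, dotProduct_zero]
    have hz0 : z = 0 := eq_zero_of_biForm_form_eq_zero hn M hM hm hc h0
    have hu0 : u = 0 := by rw [← hBz, hz0, Matrix.mulVec_zero]
    calc w = (Qn n M * (Qn n M)ᴴ) *ᵥ w := by rw [Qn_mul_conjTranspose M hn, Matrix.one_mulVec]
      _ = Qn n M *ᵥ u := by rw [← Matrix.mulVec_mulVec]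
      _ = 0 := by rw [hu0, Matrix.mulVec_zero]
  refine Matrix.mulVec_injective_iff_isUnit.1 fun w w' hww => sub_eq_zero.1 (key _ ?_)
  rw [Matrix.mulVec_sub]; exact sub_eq_zero.2 hww

end BiForm

end

end Summit.QuantumFields.BalabanUV.Beta.GAN24.WoodburyFibreGaugeBox
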